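import Summits.QuantumFields.YangMills.Theorems.BalabanUVNodesK0RecordFormatNamesLemmas11
import Summits.QuantumFields.YangMills.Theorems.BalabanUVNodesPortU8Response9

/-!
# PORT PT-B (U8), g3 file 3 — LIFT GEOMETRY: integer coordinates `siteOfInt`, the CENTRED LIFT `liftSiteCtr` as «same integer coordinates in the
# bigger torus», and its commutation with the lattice operations (`shift ∕ unshift ∕ blockOf ∕ iterBlockOf ∕ runSite`) on the centred range
# (the only obstruction is the antipodal seam block, which `NoWrapAt`'s collar excludes) — the geometric half of the (R4ᴰ-Loc) TRANSPORT lemma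

Cell `ym-nodeO-ideate` ∕ `ym-balaban-port`, porter `ymgap-nodeO-port-PTB-1` (gen 3), item **stmt-QuantumFields-27931** `BalabanUVNodes.PortPieceLocalityU8`
(text ⁷⁗ «v10-Loc» `d796c7a1386a82f1`; residue after ✓SkeletonV11 = the window transport identity `hT`).  `--supports stmt-QuantumFields-27931` (helper).
[I] = [Balaban1987RG1], [B6] = [Balaban1984PropagatorsII].

WHAT THIS FILE PROVES (theorems only; no `def ∕ instance ∕ notation ∕ sorry`; standard axioms).  `Φ := siteOfInt F K j : (Fin 4 → ℤ) → Site (F.P K) j` is a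
homomorphic image of `ℤ⁴` (B12's centred labels (0.1)): §1 `Φ` and the lattice operations GLOBALLY — `siteOfInt_add_single ∕ _sub_single` (`Φ(z ± e_μ) = Φ(z) ± e_μ`),
`runSite_siteOfInt`, `blockOf_siteOfInt` (`blockOf (Φ_j z) = Φ_{j+1} (z ∕ L)`, floor division, standing range), `iterBlockOf_siteOfInt`; §2 the centred range:
`siteOfInt_valMinAbs` (every site is `Φ` of its least-absolute-value coordinates), `valMinAbs_siteOfInt` (for `2|z| ≤ N`-type centred `z`), `siteOfInt_inj_of_abs_sub_lt`
(`Φ z = Φ z′ ∧ |z − z′| < N ⇒ z = z′`); §3 the CENTRED LIFT IS `Φ_{K+1} ∘ Φ_K⁻¹` on the centred range: `liftSiteCtr_siteOfInt`, `liftSiteCtr_injective`, and its commutation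
with `shift ∕ unshift ∕ blockOf ∕ iterBlockOf ∕ runSite` under explicit integer-range hypotheses (`liftSiteCtr_shift_of ∕ _unshift_of ∕ _blockOf_of ∕ _iterBlockOf_of ∕ _runSite_of`);
§4 the no-wrap window in integer coordinates: `mem_windowSites_siteOfInt_iff` (under `NoWrapAt`, membership in the radius-`R` cube about `z₀` IS `|z − z₀|_∞ ≤ R` on centred
labels), `mem_recordWindow_iff_abs`, `liftSiteCtr_mem_recordWindow_iff`.
HONEST FRAMING.  Lattice bookkeeping; nothing of Bałaban asserted∕ported∕discharged; 27931 OPEN · SIGNED v10-Loc · close HOLD (№495); K0⁷ OPEN; NODE O 0∕1; COUNT 8∕28 · K 1∕4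
UNMOVED; finite `𝕋⁴_{L^K}` at fixed ε — NOT continuum ∕ OS ∕ Clay; **the Yang–Mills mass gap (Clay) is NOT proved by any of this.**
-/

noncomputable section

namespace Summit.QuantumFields.YangMills.Theorems.PortU8

open Literature.MathematicalPhysics.QuantumFieldTheory.Balaban1983to89
open Literature.MathematicalPhysics.QuantumFieldTheory.Balaban1983to89.Node00
open Literature.MathematicalPhysics.QuantumFieldTheory.Balaban1983to89.T4Continuum (T4Family)
open Literature.MathematicalPhysics.QuantumFieldTheory.Balaban1983to89.B5Eq118OneStroke (iterBlockOf iterBlock)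
open Literature.MathematicalPhysics.QuantumFieldTheory.Balaban1983to89.LatticeFieldCalculus (runSite)
open Summit.QuantumFields.YangMills.Theorems.K0RecordFormatNames

variable (F : T4Family)

/-! ## §1  `Φ = siteOfInt` and the lattice operations (global) -/

/-- Components of `Φ z`. [cite: Balaban1987RG1, (0.1) p.251 (bookkeeping)] -/
theorem siteOfInt_apply (K j : ℕ) (z : Fin 4 → ℤ) (μ : Fin (F.P K).d) :
    siteOfInt F K j z μ = ((z (Fin.cast (F.P_d K) μ) : ℤ) : ZMod ((F.P K).sitesPerDir j)) := rfl

/-- `Fin (F.P K).d` IS `Fin 4`: the cast is the identity. [folklore] -/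
theorem finCast_P_d (K : ℕ) (μ : Fin (F.P K).d) : Fin.cast (F.P_d K) μ = μ := Fin.ext rfl

/-- `Φ(z + e_μ) = Φ(z) + e_μ`. [cite: Balaban1987RG1, (0.1) p.251 (bookkeeping)] -/
theorem siteOfInt_add_single (K j : ℕ) (z : Fin 4 → ℤ) (μ : Fin (F.P K).d) :
    siteOfInt F K j (z + Pi.single (Fin.cast (F.P_d K) μ) 1) = (siteOfInt F K j z).shift μ := by
  funext ν
  simp only [siteOfInt_apply, Site.shift, Pi.add_apply]
  by_cases h : ν = μ
  · subst h; rw [Function.update_self, Pi.single_eq_same]; push_cast; ring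
  · have h' : Fin.cast (F.P_d K) ν ≠ Fin.cast (F.P_d K) μ := fun e => h (by rw [finCast_P_d, finCast_P_d] at e; exact e)
    rw [Function.update_of_ne h, Pi.single_eq_of_ne h', add_zero]
    rfl

/-- `Φ(z − e_μ) = Φ(z) − e_μ`. [cite: Balaban1987RG1, (0.1) p.251 (bookkeeping)] -/
theorem siteOfInt_sub_single (K j : ℕ) (z : Fin 4 → ℤ) (μ : Fin (F.P K).d) :
    siteOfInt F K j (z - Pi.single (Fin.cast (F.P_d K) μ) 1) = (siteOfInt F K j z).unshift μ := by
  funext ν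
  simp only [siteOfInt_apply, Site.unshift, Pi.sub_apply]
  by_cases h : ν = μ
  · subst h; rw [Function.update_self, Pi.single_eq_same]; push_cast; ring
  · have h' : Fin.cast (F.P_d K) ν ≠ Fin.cast (F.P_d K) μ := fun e => h (by rw [finCast_P_d, finCast_P_d] at e; exact e)
    rw [Function.update_of_ne h, Pi.single_eq_of_ne h', sub_zero]
    rfl

/-- `Φ(z) + t·e_μ = Φ(z + t e_μ)` (the straight contour). [cite: Balaban1984PropagatorsI, (1.7) p.18 (bookkeeping)] -/
theorem runSite_siteOfInt (K j : ℕ) (z : Fin 4 → ℤ) (μ : Fin (F.P K).d) (t : ℕ) :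
    runSite (siteOfInt F K j z) μ t = siteOfInt F K j (z + Pi.single (Fin.cast (F.P_d K) μ) (t : ℤ)) := by
  funext ν
  simp only [runSite, siteOfInt_apply, Pi.add_apply]
  by_cases h : ν = μ
  · subst h; rw [Function.update_self, Pi.single_eq_same]; push_cast; ring
  · have h' : Fin.cast (F.P_d K) ν ≠ Fin.cast (F.P_d K) μ := fun e => h (by rw [finCast_P_d, finCast_P_d] at e; exact e)
    rw [Function.update_of_ne h, Pi.single_eq_of_ne h', add_zero]
    rfl

/-- **`blockOf (Φ_j z) = Φ_{j+1} (z ∕ L)`** (integer floor division; standing range `j + 1 ≤ m + K`, so `L ∣ N_j`) — GLOBAL, no centring needed.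
[cite: Balaban1987RG1, (0.3) p.252] -/
theorem blockOf_siteOfInt (K j : ℕ) (hj : j + 1 ≤ (F.P K).m + (F.P K).K) (z : Fin 4 → ℤ) :
    blockOf (siteOfInt F K j z) = siteOfInt F K (j + 1) (fun i => z i / (F.L : ℤ)) := by
  funext μ
  apply ZMod.val_injective
  rw [Site.val_blockOf hj, siteOfInt_apply, siteOfInt_apply]
  set N := (F.P K).sitesPerDir j with hN
  set N' := (F.P K).sitesPerDir (j + 1) with hN'
  have hNN : N = N' * F.L := by rw [hN, hN', (F.P K).sitesPerDir_eq_mul_succ hj]; rfl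
  have hL : (0 : ℤ) < F.L := by exact_mod_cast (F.P K).L_pos
  haveI : NeZero N := ⟨(F.P K).sitesPerDir_ne_zero j⟩
  haveI : NeZero N' := ⟨(F.P K).sitesPerDir_ne_zero (j + 1)⟩
  set w : ℤ := z (Fin.cast (F.P_d K) μ) with hw
  have h1 : (((w : ZMod N)).val : ℤ) = w % N := ZMod.val_intCast w
  have h2 : ((((w / F.L : ℤ) : ZMod N')).val : ℤ) = (w / F.L) % N' := ZMod.val_intCast _
  have hkey : ((w % N) / F.L : ℤ) = (w / F.L) % N' := by
    have hq : w % N = w - N * (w / N) := by rw [Int.emod_def]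
    rw [hq, hNN]
    push_cast
    rw [show w - (N' : ℤ) * F.L * (w / ((N' : ℤ) * F.L)) = w + (-((N' : ℤ) * (w / ((N' : ℤ) * F.L)))) * F.L by ring,
      Int.add_mul_ediv_right _ _ hL.ne', Int.emod_def, mul_comm (N' : ℤ) (F.L : ℤ), ← Int.ediv_ediv_of_nonneg hL.le]
    ring
  have h3 : ((((w : ZMod N)).val / F.L : ℕ) : ℤ) = (((((w / F.L : ℤ) : ZMod N')).val : ℕ) : ℤ) := by
    rw [Int.natCast_div, h1, h2]
    exact_mod_cast hkey
  exact_mod_cast h3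

/-- **`iterBlockOf j (Φ_0 z) = Φ_j (z ∕ L^j)`** (standing range `j ≤ m + K`) — GLOBAL. [cite: Balaban1984PropagatorsI, (1.6) p.18, (1.18) p.20] -/
theorem iterBlockOf_siteOfInt (K : ℕ) : ∀ (j : ℕ), j ≤ (F.P K).m + (F.P K).K → ∀ z : Fin 4 → ℤ,
    iterBlockOf j (siteOfInt F K 0 z) = siteOfInt F K j (fun i => z i / ((F.L : ℤ) ^ j))
  | 0, _, z => by simp
  | j + 1, hj, z => by
    rw [B5Eq118OneStroke.iterBlockOf_succ, iterBlockOf_siteOfInt K j (by omega) z, blockOf_siteOfInt F K j hj]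
    congr 1
    funext i
    rw [Int.ediv_ediv_of_nonneg (pow_nonneg (by positivity) j), pow_succ]

/-! ## §2  The centred range: least-absolute-value coordinates -/

/-- **Every site is `Φ` of its least-absolute-value coordinates.** [cite: Balaban1987RG1, (0.1) p.251 (bookkeeping)] -/
theorem siteOfInt_valMinAbs (K j : ℕ) (x : Site (F.P K) j) :
    siteOfInt F K j (fun i => ((x (Fin.cast (F.P_d K).symm i)).valMinAbs : ℤ)) = x := by
  funext μ
  rw [siteOfInt_apply]
  have h : Fin.cast (F.P_d K).symm (Fin.cast (F.P_d K) μ) = μ := Fin.ext rfl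
  rw [h, ZMod.coe_valMinAbs]

/-- The least-absolute-value coordinates are CENTRED: `−N < 2·vma ≤ N`. [folklore] -/
theorem valMinAbs_mem_Ioc' (K j : ℕ) (x : Site (F.P K) j) (μ : Fin (F.P K).d) :
    ((x μ).valMinAbs : ℤ) * 2 ∈ Set.Ioc (-((F.P K).sitesPerDir j : ℤ)) ((F.P K).sitesPerDir j) :=
  haveI : NeZero ((F.P K).sitesPerDir j) := ⟨(F.P K).sitesPerDir_ne_zero j⟩
  ZMod.valMinAbs_mem_Ioc (x μ)

/-- On CENTRED labels `Φ` is inverted by `valMinAbs`: `vma ((Φ z) μ) = z μ` for `−N < 2 z_μ ≤ N`. [cite: Balaban1987RG1, (0.1) p.251 (bookkeeping)] -/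
theorem valMinAbs_siteOfInt (K j : ℕ) (z : Fin 4 → ℤ) (μ : Fin (F.P K).d)
    (hz : z (Fin.cast (F.P_d K) μ) * 2 ∈ Set.Ioc (-((F.P K).sitesPerDir j : ℤ)) ((F.P K).sitesPerDir j)) :
    ((siteOfInt F K j z μ).valMinAbs : ℤ) = z (Fin.cast (F.P_d K) μ) := by
  haveI : NeZero ((F.P K).sitesPerDir j) := ⟨(F.P K).sitesPerDir_ne_zero j⟩
  rw [ZMod.valMinAbs_spec]
  exact ⟨rfl, hz⟩

/-- **`Φ` IS INJECTIVE ON LABELS CLOSER THAN A PERIOD**: `Φ z = Φ z′` and `|z_i − z′_i| < N` for all `i` force `z = z′`. [folklore] -/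
theorem siteOfInt_inj_of_abs_sub_lt (K j : ℕ) {z z' : Fin 4 → ℤ} (h : siteOfInt F K j z = siteOfInt F K j z')
    (hzz : ∀ i, |z i - z' i| < ((F.P K).sitesPerDir j : ℤ)) : z = z' := by
  funext i
  have hμ := congrFun h (Fin.cast (F.P_d K).symm i)
  rw [siteOfInt_apply, siteOfInt_apply] at hμ
  have hc : Fin.cast (F.P_d K) (Fin.cast (F.P_d K).symm i) = i := Fin.ext rfl
  rw [hc, ZMod.intCast_eq_intCast_iff, Int.modEq_iff_dvd] at hμ
  have hlt := hzz i
  rw [abs_sub_comm] at hlt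
  have h0 := Int.eq_zero_of_abs_lt_dvd hμ hlt
  linarith

/-- A label with `2|z_i| < N` is centred (`−N < 2 z_i ≤ N`). [folklore] -/
theorem mem_Ioc_of_two_mul_abs_lt {N : ℕ} {w : ℤ} (hw : 2 * |w| < (N : ℤ)) : w * 2 ∈ Set.Ioc (-(N : ℤ)) N := by
  constructor
  · have := neg_abs_le w; linarith
  · have := le_abs_self w; linarith

/-! ## §3  The centred lift is `Φ_{K+1} ∘ Φ_K⁻¹` on the centred range; commutation with the lattice operations -/

/-- The bigger torus has `L` times more sites per direction (standing range `j ≤ m + K`). [cite: Balaban1987RG1, (1.21) p.264 (bookkeeping)] -/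
theorem sitesPerDir_succ_vol (K j : ℕ) (hj : j ≤ F.m + K) : (F.P (K + 1)).sitesPerDir j = F.L * (F.P K).sitesPerDir j := by
  unfold Params.sitesPerDir
  simp only [T4Family.P_L, T4Family.P_m, T4Family.P_K]
  rw [show F.m + (K + 1) - j = (F.m + K - j) + 1 by omega, pow_succ]
  ring

/-- The bigger torus has at least as many sites per direction. [cite: Balaban1987RG1, (1.21) p.264 (bookkeeping)] -/
theorem sitesPerDir_le_succ_vol (K j : ℕ) (hj : j ≤ F.m + K) : (F.P K).sitesPerDir j ≤ (F.P (K + 1)).sitesPerDir j := by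
  rw [sitesPerDir_succ_vol F K j hj]
  exact Nat.le_mul_of_pos_left _ (F.P K).L_pos

/-- ★ **THE CENTRED LIFT IN INTEGER COORDINATES**: for a centred label (`−N_j(K) < 2 z_i ≤ N_j(K)`), `lift (Φ_K z) = Φ_{K+1} z` — «the same integer coordinates in the
bigger torus». [cite: Balaban1987RG1, (1.21) p.264] -/
theorem liftSiteCtr_siteOfInt (K j : ℕ) (z : Fin 4 → ℤ) (hz : ∀ i, z i * 2 ∈ Set.Ioc (-((F.P K).sitesPerDir j : ℤ)) ((F.P K).sitesPerDir j)) :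
    liftSiteCtr F K j (siteOfInt F K j z) = siteOfInt F (K + 1) j z := by
  funext μ
  show ((((siteOfInt F K j z μ).valMinAbs : ℤ)) : ZMod ((F.P (K + 1)).sitesPerDir j)) = siteOfInt F (K + 1) j z μ
  rw [valMinAbs_siteOfInt F K j z μ (hz _)]
  rfl

/-- The centred lift of ANY site, in integer coordinates: `lift x = Φ_{K+1} (vma x)`. [cite: Balaban1987RG1, (1.21) p.264 (bookkeeping)] -/
theorem liftSiteCtr_eq_siteOfInt (K j : ℕ) (x : Site (F.P K) j) :
    liftSiteCtr F K j x = siteOfInt F (K + 1) j (fun i => ((x (Fin.cast (F.P_d K).symm i)).valMinAbs : ℤ)) := by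
  conv_lhs => rw [← siteOfInt_valMinAbs F K j x]
  exact liftSiteCtr_siteOfInt F K j _ fun i => valMinAbs_mem_Ioc' F K j x _

/-- **The centred lift is injective** (standing range). [cite: Balaban1987RG1, (1.21) p.264 (bookkeeping)] -/
theorem liftSiteCtr_injective (K j : ℕ) (hj : j ≤ F.m + K) : Function.Injective (liftSiteCtr F K j) := by
  intro x x' h
  rw [liftSiteCtr_eq_siteOfInt, liftSiteCtr_eq_siteOfInt] at h
  have hN := sitesPerDir_le_succ_vol F K j hj
  have key := siteOfInt_inj_of_abs_sub_lt F (K + 1) j h fun i => by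
    have h1 := valMinAbs_mem_Ioc' F K j x (Fin.cast (F.P_d K).symm i)
    have h2 := valMinAbs_mem_Ioc' F K j x' (Fin.cast (F.P_d K).symm i)
    rw [abs_lt]
    have hN' : ((F.P K).sitesPerDir j : ℤ) ≤ (F.P (K + 1)).sitesPerDir j := by exact_mod_cast hN
    constructor <;> linarith [h1.1, h1.2, h2.1, h2.2]
  rw [← siteOfInt_valMinAbs F K j x, ← siteOfInt_valMinAbs F K j x', key]

/-- The centred lift of bonds is injective. [cite: Balaban1987RG1, (1.21) p.264 (bookkeeping)] -/
theorem liftBondCtr_injective (K j : ℕ) (hj : j ≤ F.m + K) : Function.Injective (liftBondCtr F K j) := by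
  intro b b' h
  have hs : (liftBondCtr F K j b).src = (liftBondCtr F K j b').src := congrArg PBond.src h
  have hd : (liftBondCtr F K j b).dir = (liftBondCtr F K j b').dir := congrArg PBond.dir h
  change liftSiteCtr F K j b.src = liftSiteCtr F K j b'.src at hs
  change b.dir = b'.dir at hd
  cases b; cases b'
  simp only at hs hd
  rw [liftSiteCtr_injective F K j hj hs, hd]

/-- **Lift and `+e_μ` commute in integer coordinates**: if `z` and `z + e_μ` are both centred for `N_j(K)`, `lift (Φ z + e_μ) = lift (Φ z) + e_μ`.
[cite: Balaban1987RG1, (1.21) p.264 (bookkeeping)] -/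
theorem liftSiteCtr_shift_of (K j : ℕ) (z : Fin 4 → ℤ) (μ : Fin (F.P K).d)
    (hz : ∀ i, z i * 2 ∈ Set.Ioc (-((F.P K).sitesPerDir j : ℤ)) ((F.P K).sitesPerDir j))
    (hz' : ∀ i, (z + Pi.single (Fin.cast (F.P_d K) μ) (1 : ℤ) : Fin 4 → ℤ) i * 2 ∈ Set.Ioc (-((F.P K).sitesPerDir j : ℤ)) ((F.P K).sitesPerDir j)) :
    liftSiteCtr F K j ((siteOfInt F K j z).shift μ) = (liftSiteCtr F K j (siteOfInt F K j z)).shift μ := by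
  rw [← siteOfInt_add_single, liftSiteCtr_siteOfInt F K j _ hz', liftSiteCtr_siteOfInt F K j _ hz, ← siteOfInt_add_single]
  rfl

/-- **Lift and `−e_μ` commute in integer coordinates** (both labels centred). [cite: Balaban1987RG1, (1.21) p.264 (bookkeeping)] -/
theorem liftSiteCtr_unshift_of (K j : ℕ) (z : Fin 4 → ℤ) (μ : Fin (F.P K).d)
    (hz : ∀ i, z i * 2 ∈ Set.Ioc (-((F.P K).sitesPerDir j : ℤ)) ((F.P K).sitesPerDir j))
    (hz' : ∀ i, (z - Pi.single (Fin.cast (F.P_d K) μ) (1 : ℤ) : Fin 4 → ℤ) i * 2 ∈ Set.Ioc (-((F.P K).sitesPerDir j : ℤ)) ((F.P K).sitesPerDir j)) :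
    liftSiteCtr F K j ((siteOfInt F K j z).unshift μ) = (liftSiteCtr F K j (siteOfInt F K j z)).unshift μ := by
  rw [← siteOfInt_sub_single, liftSiteCtr_siteOfInt F K j _ hz', liftSiteCtr_siteOfInt F K j _ hz, ← siteOfInt_sub_single]
  rfl

/-- **Lift and the straight contour commute in integer coordinates** (start and end-label range centred). [cite: Balaban1984PropagatorsI, (1.7) p.18 (bookkeeping)] -/
theorem liftSiteCtr_runSite_of (K j : ℕ) (z : Fin 4 → ℤ) (μ : Fin (F.P K).d) (t : ℕ)
    (hz : ∀ i, z i * 2 ∈ Set.Ioc (-((F.P K).sitesPerDir j : ℤ)) ((F.P K).sitesPerDir j))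
    (hz' : ∀ i, (z + Pi.single (Fin.cast (F.P_d K) μ) (t : ℤ) : Fin 4 → ℤ) i * 2 ∈ Set.Ioc (-((F.P K).sitesPerDir j : ℤ)) ((F.P K).sitesPerDir j)) :
    liftSiteCtr F K j (runSite (siteOfInt F K j z) μ t) = runSite (liftSiteCtr F K j (siteOfInt F K j z)) μ t := by
  rw [runSite_siteOfInt, liftSiteCtr_siteOfInt F K j _ hz', liftSiteCtr_siteOfInt F K j _ hz, runSite_siteOfInt]
  rfl

/-- **Lift and `blockOf` commute in integer coordinates**: if `z` is centred for `N_j(K)` and `z ∕ L` is centred for `N_{j+1}(K)` (standing range), then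
`lift (blockOf (Φ_j z)) = blockOf (lift (Φ_j z))`. [cite: Balaban1987RG1, (0.3) p.252, (1.21) p.264 (bookkeeping)] -/
theorem liftSiteCtr_blockOf_of (K j : ℕ) (hj : j + 1 ≤ F.m + K) (z : Fin 4 → ℤ)
    (hz : ∀ i, z i * 2 ∈ Set.Ioc (-((F.P K).sitesPerDir j : ℤ)) ((F.P K).sitesPerDir j))
    (hzL : ∀ i, (z i / (F.L : ℤ)) * 2 ∈ Set.Ioc (-((F.P K).sitesPerDir (j + 1) : ℤ)) ((F.P K).sitesPerDir (j + 1))) :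
    liftSiteCtr F K (j + 1) (blockOf (siteOfInt F K j z)) = blockOf (liftSiteCtr F K j (siteOfInt F K j z)) := by
  have hjK : j + 1 ≤ (F.P K).m + (F.P K).K := by simpa using hj
  have hjK' : j + 1 ≤ (F.P (K + 1)).m + (F.P (K + 1)).K := by simp only [T4Family.P_m, T4Family.P_K]; omega
  rw [blockOf_siteOfInt F K j hjK, liftSiteCtr_siteOfInt F K (j + 1) _ hzL, liftSiteCtr_siteOfInt F K j _ hz, blockOf_siteOfInt F (K + 1) j hjK']

/-- **Lift and `iterBlockOf` commute in integer coordinates**: if `z` is centred for `N_0(K)` and `z ∕ L^j` for `N_j(K)` (standing range), then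
`lift_j (iterBlockOf j (Φ_0 z)) = iterBlockOf j (lift_0 (Φ_0 z))`. [cite: Balaban1984PropagatorsI, (1.18) p.20; Balaban1987RG1, (1.21) p.264 (bookkeeping)] -/
theorem liftSiteCtr_iterBlockOf_of (K j : ℕ) (hj : j ≤ F.m + K) (z : Fin 4 → ℤ)
    (hz : ∀ i, z i * 2 ∈ Set.Ioc (-((F.P K).sitesPerDir 0 : ℤ)) ((F.P K).sitesPerDir 0))
    (hzj : ∀ i, (z i / ((F.L : ℤ) ^ j)) * 2 ∈ Set.Ioc (-((F.P K).sitesPerDir j : ℤ)) ((F.P K).sitesPerDir j)) :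
    liftSiteCtr F K j (iterBlockOf j (siteOfInt F K 0 z)) = iterBlockOf j (liftSiteCtr F K 0 (siteOfInt F K 0 z)) := by
  have hjK : j ≤ (F.P K).m + (F.P K).K := by simpa using hj
  have hjK' : j ≤ (F.P (K + 1)).m + (F.P (K + 1)).K := by simp only [T4Family.P_m, T4Family.P_K]; omega
  rw [iterBlockOf_siteOfInt F K j hjK, liftSiteCtr_siteOfInt F K j _ hzj, liftSiteCtr_siteOfInt F K 0 _ hz, iterBlockOf_siteOfInt F (K + 1) j hjK']

end Summit.QuantumFields.YangMills.Theorems.PortU8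

end
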